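import Summits.ValiantsHypothesis.ValiantsHypothesis.Theorems.LacunarySymmetroidMatrixDescartesPivotRankOneFourKillSeven

/-!
# `MatrixDescartes` census — rank-one `(2,4)₁`, ONE below / THREE above: `Z₊ ≤ 8` under the far-type condition (T₁₃)
# (kept degrees `2e, e+d₁, e+d₃, d₁+d₃`; the fourth chamber-(C) kill-seven set, the main one the located census asked for)

HONEST FRAMING.  Object-search cell `pub-symmetroid`, seat `val-sym-mdr-p1` (generation 14); helper file `--supports` the crux item
stmt-ValiantsHypothesis-18050 (`Theses.LacunarySymmetroid.MatrixDescartes`, OPEN, on HOLD) with NO closure claim.  Companion of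
`…PivotRankOneOneThreeKillSeven` ((T₀₃), (T₀₁), (T₁₂)) and `…PivotRankOneOneThreeKillEight` (circuit triples) for chamber (C) of the
split `d₀ < e < d₁ < d₂ < d₃`.  Kept set `{2e, e+d₁, e+d₃, d₁+d₃} = {e, d₃} + {e, d₁}`; killing the seven other degrees leaves
`A X^{2e} − B X^{e+d₁} + C X^{e+d₃} − D X^{d₁+d₃}` with `B = w₁|m₁|·Π_B`, `D = w₁w₃Δ₁₃²·Π_D`, and the four-nomial lemma's hypothesis is
**(T₁₃) `m₁m₃·Π_BΠ_C ≤ |det J|·Δ₁₃²·Π_AΠ_D`** — in `t`-coordinates `σ₁₃ ≥ 4·Π_BΠ_C/(Π_AΠ_D)`: the above-pivot letters `1` and `3`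
FAR apart in angle.  `J` arbitrary (for `det J ≥ 0` and `m₃ < 0` the condition is void), `m₁ < 0`, `Δ₁₃ ≠ 0`, `w₁, w₃ > 0`; exponent
hypotheses `d₀+d₂ < e+d₁ < d₀+d₃` only.  Theorems `elevenNomial_oneThree_T13_le_eight`, `oneThree_rankOne_posRoots_le_eight_of_T13`.
LOCATED (seat exp/coverC.py, ≈ 1.4·10⁵ adversarial samples of chamber (C) × directions × weights): beyond {T₀₃, T₀₁, T₁₂} ∪ {four
circuit triples} (≈ 98.9 %), the set (T₁₃) covers ≈ 90 % of the remainder; two small S-type sets and one certificate-free sample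
(`Z₊ = 1`) remain — located coverage of (C) is NOT closed and no covering is claimed.  Nothing here bears on `MatrixDescartes` in its
window, on `DoorA26` / `DoorA34`, registers / credences, or `VP ≠ VNP`.

[folklore] The engine of `…PivotTwoDirectionsBlockLaw`; `2 × 2` determinant algebra.  No definitions, no named facts.
-/

-- `Summit.ValiantsHypothesis.ValiantsHypothesis.…` repeats a component by the D-0017 layout
-- (single-conjunct summit), which the `dupNamespace` linter flags; the name is mandated.
set_option linter.dupNamespace false

namespace Summit.ValiantsHypothesis.ValiantsHypothesis.Theorems.LacunarySymmetroidMatrixDescartes.Pivot.TwoDirections.BlockLaw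

open Polynomial Matrix Finset
open scoped BigOperators

/-- **(T₁₃), real-parameter form.**  The eleven-nomial of the split `d₀ < e < d₁ < d₂ < d₃` with `d₀+d₂ < e+d₁ < d₀+d₃` (`m₁ < 0`,
`D13 > 0`, `w₁, w₃ > 0`; `dJ`, `m₃` and everything else arbitrary) has at most EIGHT positive roots under (T₁₃) (kept degrees
`2e, e+d₁, e+d₃, d₁+d₃`). -/
theorem elevenNomial_oneThree_T13_le_eight (e d₀ d₁ d₂ d₃ : ℕ) (h0e : d₀ < e) (he1 : e < d₁) (h12 : d₁ < d₂) (h23 : d₂ < d₃)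
    (hC3 : d₀ + d₂ < e + d₁) (hC4 : e + d₁ < d₀ + d₃)
    (dJ m₀ m₁ m₂ m₃ w₀ w₁ w₂ w₃ D01 D02 D03 D12 D13 D23 : ℝ) (hw₁ : 0 < w₁) (hw₃ : 0 < w₃) (hm₁ : m₁ < 0) (hD13 : 0 < D13)
    (hS : m₁ * m₃
        * (((d₁ : ℝ) - d₀) * ((d₂ : ℝ) - d₁) * ((e : ℝ) - d₀) * ((e : ℝ) + d₁ - d₀ - d₂) * ((d₀ : ℝ) + d₃ - e - d₁) * ((d₂ : ℝ) - e) * ((d₂ : ℝ) + d₃ - e - d₁))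
        * (((d₃ : ℝ) - d₀) * ((d₃ : ℝ) - d₂) * ((e : ℝ) + d₃ - d₀ - d₁) * ((e : ℝ) + d₃ - d₀ - d₂) * ((e : ℝ) - d₀) * ((e : ℝ) + d₃ - d₁ - d₂) * ((d₂ : ℝ) - e))
        ≤ (-dJ) * D13
        * (((e : ℝ) - d₀) * ((d₂ : ℝ) - e) * ((2 : ℝ) * e - d₀ - d₁) * ((d₀ : ℝ) + d₂ - 2 * e) * ((d₀ : ℝ) + d₃ - 2 * e) * ((d₁ : ℝ) + d₂ - 2 * e) * ((d₂ : ℝ) + d₃ - 2 * e))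
        * (((d₁ : ℝ) + d₃ - e - d₀) * ((d₁ : ℝ) + d₃ - e - d₂) * ((d₃ : ℝ) - d₀) * ((d₁ : ℝ) + d₃ - d₀ - d₂) * ((d₁ : ℝ) - d₀) * ((d₃ : ℝ) - d₂) * ((d₂ : ℝ) - d₁))) :
    ((∑ i : Fin 11, Polynomial.C ((![dJ, w₀ * m₀, w₁ * m₁, w₂ * m₂, w₃ * m₃, w₀ * w₁ * D01, w₀ * w₂ * D02, w₀ * w₃ * D03, w₁ * w₂ * D12, w₁ * w₃ * D13, w₂ * w₃ * D23] : Fin 11 → ℝ) i) * X ^ ((![2 * e, e + d₀, e + d₁, e + d₂, e + d₃, d₀ + d₁, d₀ + d₂, d₀ + d₃, d₁ + d₂, d₁ + d₃, d₂ + d₃] : Fin 11 → ℕ) i)).roots.toFinset.filter (fun t => 0 < t)).card ≤ 8 := by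
  classical
  have h0e' : (d₀ : ℝ) < e := by exact_mod_cast h0e
  have he1' : (e : ℝ) < d₁ := by exact_mod_cast he1
  have h12' : (d₁ : ℝ) < d₂ := by exact_mod_cast h12
  have h23' : (d₂ : ℝ) < d₃ := by exact_mod_cast h23
  have hC3' : (d₀ : ℝ) + d₂ < e + d₁ := by exact_mod_cast hC3
  have hC4' : (e : ℝ) + d₁ < d₀ + d₃ := by exact_mod_cast hC4
  -- the four distance products (positive atoms)
  obtain ⟨PA, hPA⟩ : ∃ x : ℝ, x = ((e : ℝ) - d₀) * ((d₂ : ℝ) - e) * ((2 : ℝ) * e - d₀ - d₁) * ((d₀ : ℝ) + d₂ - 2 * e) * ((d₀ : ℝ) + d₃ - 2 * e) * ((d₁ : ℝ) + d₂ - 2 * e) * ((d₂ : ℝ) + d₃ - 2 * e) := ⟨_, rfl⟩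
  obtain ⟨PB, hPB⟩ : ∃ x : ℝ, x = ((d₁ : ℝ) - d₀) * ((d₂ : ℝ) - d₁) * ((e : ℝ) - d₀) * ((e : ℝ) + d₁ - d₀ - d₂) * ((d₀ : ℝ) + d₃ - e - d₁) * ((d₂ : ℝ) - e) * ((d₂ : ℝ) + d₃ - e - d₁) := ⟨_, rfl⟩
  obtain ⟨PC, hPC⟩ : ∃ x : ℝ, x = ((d₃ : ℝ) - d₀) * ((d₃ : ℝ) - d₂) * ((e : ℝ) + d₃ - d₀ - d₁) * ((e : ℝ) + d₃ - d₀ - d₂) * ((e : ℝ) - d₀) * ((e : ℝ) + d₃ - d₁ - d₂) * ((d₂ : ℝ) - e) := ⟨_, rfl⟩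
  obtain ⟨PD, hPD⟩ : ∃ x : ℝ, x = ((d₁ : ℝ) + d₃ - e - d₀) * ((d₁ : ℝ) + d₃ - e - d₂) * ((d₃ : ℝ) - d₀) * ((d₁ : ℝ) + d₃ - d₀ - d₂) * ((d₁ : ℝ) - d₀) * ((d₃ : ℝ) - d₂) * ((d₂ : ℝ) - d₁) := ⟨_, rfl⟩
  have hS' : m₁ * m₃ * PB * PC ≤ (-dJ) * D13 * PA * PD := by rw [hPA, hPB, hPC, hPD]; exact hS
  clear hS
  have hPBp : 0 < PB := by
    rw [hPB]
    have f1 : 0 < ((d₁ : ℝ) - d₀) := by linarith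
    have f2 : 0 < ((d₂ : ℝ) - d₁) := by linarith
    have f3 : 0 < ((e : ℝ) - d₀) := by linarith
    have f4 : 0 < ((e : ℝ) + d₁ - d₀ - d₂) := by linarith
    have f5 : 0 < ((d₀ : ℝ) + d₃ - e - d₁) := by linarith
    have f6 : 0 < ((d₂ : ℝ) - e) := by linarith
    have f7 : 0 < ((d₂ : ℝ) + d₃ - e - d₁) := by linarith
    exact mul_pos (mul_pos (mul_pos (mul_pos (mul_pos (mul_pos f1 f2) f3) f4) f5) f6) f7
  have hPDp : 0 < PD := by
    rw [hPD]
    have f1 : 0 < ((d₁ : ℝ) + d₃ - e - d₀) := by linarith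
    have f2 : 0 < ((d₁ : ℝ) + d₃ - e - d₂) := by linarith
    have f3 : 0 < ((d₃ : ℝ) - d₀) := by linarith
    have f4 : 0 < ((d₁ : ℝ) + d₃ - d₀ - d₂) := by linarith
    have f5 : 0 < ((d₁ : ℝ) - d₀) := by linarith
    have f6 : 0 < ((d₃ : ℝ) - d₂) := by linarith
    have f7 : 0 < ((d₂ : ℝ) - d₁) := by linarith
    exact mul_pos (mul_pos (mul_pos (mul_pos (mul_pos (mul_pos f1 f2) f3) f4) f5) f6) f7
  -- the four surviving coefficients
  obtain ⟨A, hA⟩ : ∃ x : ℝ, x = (-dJ) * PA := ⟨_, rfl⟩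
  obtain ⟨B, hB⟩ : ∃ x : ℝ, x = w₁ * (-m₁) * PB := ⟨_, rfl⟩
  obtain ⟨C, hC⟩ : ∃ x : ℝ, x = w₃ * (-m₃) * PC := ⟨_, rfl⟩
  obtain ⟨D, hD⟩ : ∃ x : ℝ, x = w₁ * w₃ * D13 * PD := ⟨_, rfl⟩
  have hBp : 0 < B := by rw [hB]; exact mul_pos (mul_pos hw₁ (by linarith)) hPBp
  have hDp : 0 < D := by rw [hD]; exact mul_pos (mul_pos (mul_pos hw₁ hw₃) hD13) hPDp
  have hBC : B * C ≤ A * D := by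
    have e1 : B * C = (w₁ * w₃) * (m₁ * m₃ * PB * PC) := by rw [hB, hC]; ring
    have e2 : A * D = (w₁ * w₃) * ((-dJ) * D13 * PA * PD) := by rw [hA, hD]; ring
    rw [e1, e2]
    exact mul_le_mul_of_nonneg_left hS' (mul_pos hw₁ hw₃).le
  -- seven kills
  have hkills := card_posRoots_le_kills (Finset.univ : Finset (Fin 11)) (![2 * e, e + d₀, e + d₁, e + d₂, e + d₃, d₀ + d₁, d₀ + d₂, d₀ + d₃, d₁ + d₂, d₁ + d₃, d₂ + d₃] : Fin 11 → ℕ) [e + d₀, e + d₂, d₀ + d₁, d₀ + d₂, d₀ + d₃, d₁ + d₂, d₂ + d₃] (![dJ, w₀ * m₀, w₁ * m₁, w₂ * m₂, w₃ * m₃, w₀ * w₁ * D01, w₀ * w₂ * D02, w₀ * w₃ * D03, w₁ * w₂ * D12, w₁ * w₃ * D13, w₂ * w₃ * D23] : Fin 11 → ℝ)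
  have hfour : (∑ i ∈ (Finset.univ : Finset (Fin 11)), Polynomial.C ((![dJ, w₀ * m₀, w₁ * m₁, w₂ * m₂, w₃ * m₃, w₀ * w₁ * D01, w₀ * w₂ * D02, w₀ * w₃ * D03, w₁ * w₂ * D12, w₁ * w₃ * D13, w₂ * w₃ * D23] : Fin 11 → ℝ) i
          * (([e + d₀, e + d₂, d₀ + d₁, d₀ + d₂, d₀ + d₃, d₁ + d₂, d₂ + d₃]).map (fun ρ : ℕ => (((((![2 * e, e + d₀, e + d₁, e + d₂, e + d₃, d₀ + d₁, d₀ + d₂, d₀ + d₃, d₁ + d₂, d₁ + d₃, d₂ + d₃] : Fin 11 → ℕ)) i : ℕ) : ℝ) - (ρ : ℝ)))).prod) * X ^ ((![2 * e, e + d₀, e + d₁, e + d₂, e + d₃, d₀ + d₁, d₀ + d₂, d₀ + d₃, d₁ + d₂, d₁ + d₃, d₂ + d₃] : Fin 11 → ℕ) i))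
      = (Polynomial.C A * X ^ (2 * e) - Polynomial.C B * X ^ (2 * e + (d₁ - e))
          + Polynomial.C C * X ^ (2 * e + (d₃ - e)) - Polynomial.C D * X ^ (2 * e + (d₁ - e) + (d₃ - e))) := by
    have e3 : 2 * e + (d₁ - e) + (d₃ - e) = d₁ + d₃ := by omega
    have e1 : 2 * e + (d₁ - e) = e + d₁ := by omega
    have e2 : 2 * e + (d₃ - e) = e + d₃ := by omega
    rw [e3, e1, e2]
    have hcoef : ∀ i : Fin 11, (![dJ, w₀ * m₀, w₁ * m₁, w₂ * m₂, w₃ * m₃, w₀ * w₁ * D01, w₀ * w₂ * D02, w₀ * w₃ * D03, w₁ * w₂ * D12, w₁ * w₃ * D13, w₂ * w₃ * D23] : Fin 11 → ℝ) i * (([e + d₀, e + d₂, d₀ + d₁, d₀ + d₂, d₀ + d₃, d₁ + d₂, d₂ + d₃]).map (fun ρ : ℕ => (((((![2 * e, e + d₀, e + d₁, e + d₂, e + d₃, d₀ + d₁, d₀ + d₂, d₀ + d₃, d₁ + d₂, d₁ + d₃, d₂ + d₃] : Fin 11 → ℕ)) i : ℕ) : ℝ) - (ρ : ℝ)))).p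rod
        = (![A, 0, -B, 0, C, 0, 0, 0, 0, -D, 0] : Fin 11 → ℝ) i := by
      intro i
      fin_cases i <;>
        simp only [Fin.zero_eta, Fin.mk_one, Fin.isValue, Matrix.cons_val_zero, Matrix.cons_val_one,
          List.map_cons, List.map_nil, List.prod_cons, List.prod_nil, hA, hB, hC, hD, hPA, hPB, hPC, hPD] <;>
        push_cast <;> ring
    rw [Finset.sum_congr rfl (fun i _ => by rw [hcoef i])]
    simp only [Fin.sum_univ_succ, Fin.sum_univ_zero, Matrix.cons_val_zero, Matrix.cons_val_succ, map_zero, zero_mul,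
      zero_add, add_zero, Polynomial.C_neg]
    ring
  rw [hfour] at hkills
  have hone := card_posRoots_fourNomial_le_one A B C D hBp hDp hBC (2 * e) (d₁ - e) (d₃ - e) (by omega)
  simp only [List.length_cons, List.length_nil] at hkills
  omega

/-- **RANK-ONE `(2,4)₁`, ONE BELOW / THREE ABOVE: `Z₊ ≤ 8` under (T₁₃)** (matrix form; `J` arbitrary, letter `1` pairing negatively with `J`,
letters `1, 3` not parallel, `w₁, w₃ > 0`). [this file] -/
theorem oneThree_rankOne_posRoots_le_eight_of_T13 (e d₀ d₁ d₂ d₃ : ℕ) (h0e : d₀ < e) (he1 : e < d₁) (h12 : d₁ < d₂) (h23 : d₂ < d₃)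
    (hC3 : d₀ + d₂ < e + d₁) (hC4 : e + d₁ < d₀ + d₃)
    (J : Matrix (Fin 2) (Fin 2) ℝ) (v₀ v₁ v₂ v₃ : Fin 2 → ℝ) (w₀ w₁ w₂ w₃ : ℝ) (hw₁ : 0 < w₁) (hw₃ : 0 < w₃) (hm₁ : (J 0 0 * v₁ 1 ^ 2 + J 1 1 * v₁ 0 ^ 2 - (J 0 1 + J 1 0) * (v₁ 0 * v₁ 1)) < 0)
    (hv13 : v₁ 0 * v₃ 1 - v₁ 1 * v₃ 0 ≠ 0)
    (hS : (J 0 0 * v₁ 1 ^ 2 + J 1 1 * v₁ 0 ^ 2 - (J 0 1 + J 1 0) * (v₁ 0 * v₁ 1)) * (J 0 0 * v₃ 1 ^ 2 + J 1 1 * v₃ 0 ^ 2 - (J 0 1 + J 1 0) * (v₃ 0 * v₃ 1))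
        * (((d₁ : ℝ) - d₀) * ((d₂ : ℝ) - d₁) * ((e : ℝ) - d₀) * ((e : ℝ) + d₁ - d₀ - d₂) * ((d₀ : ℝ) + d₃ - e - d₁) * ((d₂ : ℝ) - e) * ((d₂ : ℝ) + d₃ - e - d₁))
        * (((d₃ : ℝ) - d₀) * ((d₃ : ℝ) - d₂) * ((e : ℝ) + d₃ - d₀ - d₁) * ((e : ℝ) + d₃ - d₀ - d₂) * ((e : ℝ) - d₀) * ((e : ℝ) + d₃ - d₁ - d₂) * ((d₂ : ℝ) - e))
        ≤ (-J.det) * ((v₁ 0 * v₃ 1 - v₁ 1 * v₃ 0) ^ 2)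
        * (((e : ℝ) - d₀) * ((d₂ : ℝ) - e) * ((2 : ℝ) * e - d₀ - d₁) * ((d₀ : ℝ) + d₂ - 2 * e) * ((d₀ : ℝ) + d₃ - 2 * e) * ((d₁ : ℝ) + d₂ - 2 * e) * ((d₂ : ℝ) + d₃ - 2 * e))
        * (((d₁ : ℝ) + d₃ - e - d₀) * ((d₁ : ℝ) + d₃ - e - d₂) * ((d₃ : ℝ) - d₀) * ((d₁ : ℝ) + d₃ - d₀ - d₂) * ((d₁ : ℝ) - d₀) * ((d₃ : ℝ) - d₂) * ((d₂ : ℝ) - d₁))) :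
    ((Matrix.det (((X : ℝ[X]) ^ e) • J.map Polynomial.C
        + (Polynomial.C w₀ * X ^ d₀) • (vecMulVec v₀ v₀).map Polynomial.C
        + (Polynomial.C w₁ * X ^ d₁) • (vecMulVec v₁ v₁).map Polynomial.C
        + (Polynomial.C w₂ * X ^ d₂) • (vecMulVec v₂ v₂).map Polynomial.C
        + (Polynomial.C w₃ * X ^ d₃) • (vecMulVec v₃ v₃).map Polynomial.C)).roots.toFinset.filter (fun t => 0 < t)).card
      ≤ 8 := by
  rw [det_rankOne_four_sum]
  exact elevenNomial_oneThree_T13_le_eight e d₀ d₁ d₂ d₃ h0e he1 h12 h23 hC3 hC4 J.det _ _ _ _ w₀ w₁ w₂ w₃ _ _ _ _ _ _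
    hw₁ hw₃ hm₁ (by positivity) hS

end Summit.ValiantsHypothesis.ValiantsHypothesis.Theorems.LacunarySymmetroidMatrixDescartes.Pivot.TwoDirections.BlockLaw
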